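import Mathlib
import Summits.NavierStokesRegularity.NavierStokesRegularity.Theorems.TaoLadderRungTwoFlatCaptureContinuity
import Summits.NavierStokesRegularity.NavierStokesRegularity.Theorems.TaoLadderRungTwoFlatTubeStepLandSplit
import HarnessLib

/-!
# THE CAPTURE HOP `TubeStepCaptureWith` AT THE CHOICE RULE (hops `n + 1 ≤ N₀`), from finite-time continuity against a reference flow
  (helper for the K_A♭ parent item stmt-NavierStokesRegularity-22987 `FlatGapCertificatesV2`, child 2A `GradedAdiabaticWakeA` of route
  TaoLadderRungTwoFlat; cell harvest/h2-tao-ladder, p1 g25; LADDER §47.5 L1/L3, §50 (`TubeStepCapture`), §52 (capture → entry))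

In the capture phase the tube `H(n)` is the sup-ball of radius `η n` around the centre `ζ n` (plus the ahead clause). Along a premise
(tube state `z`, kick `S₀`, exact graded flow `S` on `[0, τ] ⊇ [0, c₀]`) the flow stays sup-close to the REFERENCE FLOW `Z` of the hop
— an exact graded flow from the centre `ζ n` on `[0, c₀]` with `max(1, c_k)|Z_k| ≤ M_Z` — by the a-priori-free continuity
`sup_deviation_of_gradedFlows`: `|S − Z|(s) ≤ D := B·e^{Lc₀}` at every site, `B = 5r/4 + c_{k₁}·η n` the weighted initial distance
(kick + capture ball + both tails ahead of `k₁`, `captureStart_le`). At a good time `t` the re-centred state `S(1+·, t)/a`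
(`a` the clamped ratio of `S`) is then within `D·(1/f + M_Z/(A_* f²)) + ρ` of the next centre `ζ(n+1)` (`f = (1+ε₀)^{−θ₀}` the ratio
floor; the clamped ratio is `1/A_*`-Lipschitz in the carrier; `ρ` = the reference-only row: `Z(1+·, t)/a_Z(t)` within `ρ` of `ζ(n+1)` on
the clock window), and its AHEAD clause follows from the cut schedule of `…AheadCuts` with the window rows and the window-top hull read off
the reference plus `D`.

* `capture_of_inTubeWith_le` — `H(n)` for `n ≤ N₀` is capture ∧ ahead (hop `0`: the datum IS the centre `ζ 0`);
* `captureStart_le` — the weighted initial distance `max(1,c_k)|S₀ − ζ n|_k ≤ 5r/4 + c_{k₁}·η n`;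
* `abs_clampedRatio_sub_le` — the clamped ratio is `1/A_*`-Lipschitz in the carrier amplitude;
* `recentre_sub_le_of_dev` — the capture inequality from a sup deviation `D`, the reference bound and the reference row;
* `tubeStepCaptureWith_of_continuity` — **`TubeStepCaptureWith` of any slot at the choice rule, hop `n + 1 ≤ N₀`**, from the reference flow
  of the hop and scalar rows (budget `D·(1/f + M_Z/(A_* f²)) + ρ ≤ η(n+1)`, window rows, cut schedule).

HONEST FRAMING: composition over the cell's typed induction frame (MODEL lattice, graded mirror table on `S♭`); the reference flows, their
bounds and rows are HYPOTHESES; nothing certified; no item closed; nothing about the Navier–Stokes equations.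
-/

noncomputable section

-- the sub-problem namespace repeats the summit name by design (D-0017)
set_option linter.dupNamespace false

namespace Summit.NavierStokesRegularity.NavierStokesRegularity.Theorems.HopTube

open Set Finset Literature.Analysis.FluidPDE Literature.Analysis.FluidPDE.TaoCascade MirrorPulse RenormFrame QuadPolar
  GappedFrontRobustOn

/-- **`H(n)` in the capture phase** (`n ≤ N₀`): capture ball ∧ ahead clause — at hop `0` because the datum is the centre `ζ 0` and
vanishes off shell `0`. [cite: Tao2016AveragedNS, §6.3–6.4 (statement shape); cell LADDER §50 (capture phase)] -/
theorem capture_of_inTubeWith_le (P : TubeSchedule) {Bcl : ℕ → (Fin 2 → ℤ → ℝ) → Prop} {i₀ : Fin 2} {X₀ : Fin 2 → ℝ}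
    {w : ℤ → ℝ} {r : ℝ} {ζ : ℕ → Fin 2 → ℤ → ℝ} {ustar : Fin 2 → ℤ → ℝ} {n : ℕ} {z : Fin 2 → ℤ → ℝ}
    (hn : n ≤ P.N₀) (hζ0 : ζ 0 = datumState i₀ X₀) (hη0 : 0 ≤ P.η 0) (hk₁ : 1 ≤ P.k₁) (hr : 0 ≤ r)
    (hz : InTubeWith P Bcl i₀ X₀ w r ζ ustar n z) : CaptureClause P ζ n z ∧ AheadClause P w r z := by
  by_cases h0 : n = 0
  · subst h0
    have hz' : z = datumState i₀ X₀ := by simpa [InTubeWith] using hz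
    subst hz'
    refine ⟨fun i k => ?_, fun i k hk => ?_⟩
    · rw [hζ0, sub_self, abs_zero]; exact hη0
    · have hk0 : k ≠ 0 := by omega
      simp [datumState, hk0, hr]
  · simp only [InTubeWith, h0, if_false, if_pos hn] at hz
    exact hz

/-- **The weighted initial distance of a capture premise to the centre**: kick (`w ≥ max(1, c)` ahead, `w ≥ 1`), capture ball `η n`,
and BOTH tails ahead of `k₁` (`8w|z|, 8w|ζ n| ≤ r`) give `max(1, c_k)·|S₀ − ζ n|_k ≤ 5r/4 + c_{k₁}·η n` at every site.
[cite: Tao2016AveragedNS, §6.2 Prop. 6.3 (ix), §6.3–6.4 (statement shape); cell LADDER §47.5 L1/L3, §50] -/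
theorem captureStart_le (P : TubeSchedule) {ε₀ : ℝ} (hε₀ : 0 ≤ ε₀) {w : ℤ → ℝ} {r : ℝ} {ζ : ℕ → Fin 2 → ℤ → ℝ} {n : ℕ}
    {z S₀ : Fin 2 → ℤ → ℝ} (hcap : CaptureClause P ζ n z) (hA : AheadClause P w r z) (hζA : AheadClause P w r (ζ n))
    (hkick : ∀ i k, w k * |S₀ i k - z i k| ≤ r) (hw1 : ∀ k, 1 ≤ w k) (hwc : ∀ k : ℤ, 0 ≤ k → clockW ε₀ k ≤ w k)
    (hr : 0 ≤ r) (hη : 0 ≤ P.η n) {B : ℝ} (hB : 5 / 4 * r + clockW ε₀ P.k₁ * P.η n ≤ B) :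
    ∀ (i : Fin 2) (k : ℤ), max 1 (clockW ε₀ k) * |S₀ i k - ζ n i k| ≤ B := by
  have hε' : (-1 : ℝ) < ε₀ := by linarith
  have hc : ∀ k, 0 < clockW ε₀ k := clockW_pos hε'
  have h1ε : (1 : ℝ) ≤ 1 + ε₀ := by linarith
  have hcmono : ∀ k k' : ℤ, k ≤ k' → clockW ε₀ k ≤ clockW ε₀ k' := fun k k' hkk => by
    unfold clockW
    have hkk' : (k : ℝ) ≤ k' := by exact_mod_cast hkk
    exact Real.rpow_le_rpow_of_exponent_le h1ε (by linarith)
  have hc0 : clockW ε₀ 0 = 1 := by simp [clockW]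
  have hck₁ : 1 ≤ clockW ε₀ P.k₁ := by rw [← hc0]; exact hcmono 0 _ (by positivity)
  intro i k
  have hwk : 0 < w k := lt_of_lt_of_le one_pos (hw1 k)
  have hkick' : |S₀ i k - z i k| ≤ r / w k := by rw [le_div_iff₀ hwk, mul_comm]; exact hkick i k
  have hkr : r / w k ≤ r := div_le_self hr (hw1 k)
  have htri : |S₀ i k - ζ n i k| ≤ |S₀ i k - z i k| + |z i k - ζ n i k| := by
    have := abs_add_le (S₀ i k - z i k) (z i k - ζ n i k); simp only [sub_add_sub_cancel] at this; exact this
  have hcapk := hcap i k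
  have hX0 : 0 ≤ |S₀ i k - ζ n i k| := abs_nonneg _
  -- plain bound (serves `k < 0` and the `1`-branch of the max everywhere)
  have hplain : |S₀ i k - ζ n i k| ≤ B := by
    rcases lt_or_ge k (P.k₁ : ℤ) with hk | hk
    · have : clockW ε₀ P.k₁ * P.η n ≥ P.η n := le_mul_of_one_le_left hη hck₁
      linarith
    · have hz8 := hA i k hk
      have hζ8 := hζA i k hk
      have hz' : |z i k| ≤ r / (8 * w k) := by rw [le_div_iff₀ (by positivity)]; linarith
      have hζ' : |ζ n i k| ≤ r / (8 * w k) := by rw [le_div_iff₀ (by positivity)]; linarith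
      have hzζ : |z i k - ζ n i k| ≤ r / (8 * w k) + r / (8 * w k) := (abs_sub _ _).trans (add_le_add hz' hζ')
      have h8 : r / (8 * w k) ≤ r / 8 := div_le_div_of_nonneg_left hr (by norm_num) (by linarith [hw1 k])
      have : 0 ≤ clockW ε₀ P.k₁ * P.η n := mul_nonneg (hc _).le hη
      linarith
  rw [max_mul_of_nonneg _ _ hX0, one_mul]
  refine max_le hplain ?_
  rcases lt_or_ge k 0 with hk0 | hk0
  · -- behind: `c_k ≤ 1`
    have hc1 : clockW ε₀ k ≤ 1 := by rw [← hc0]; exact hcmono k 0 hk0.le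
    exact (mul_le_of_le_one_left hX0 hc1).trans hplain
  · have hcw : clockW ε₀ k * (r / w k) ≤ r := by
      calc clockW ε₀ k * (r / w k) ≤ w k * (r / w k) := mul_le_mul_of_nonneg_right (hwc k hk0) (div_nonneg hr hwk.le)
        _ = r := by field_simp
    rcases lt_or_ge k (P.k₁ : ℤ) with hk | hk
    · -- window below `k₁`: kick + capture ball
      have hcη : clockW ε₀ k * |z i k - ζ n i k| ≤ clockW ε₀ P.k₁ * P.η n :=
        mul_le_mul (hcmono k _ hk.le) hcapk (abs_nonneg _) (hc _).le
      calc clockW ε₀ k * |S₀ i k - ζ n i k| ≤ clockW ε₀ k * (|S₀ i k - z i k| + |z i k - ζ n i k|) :=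
            mul_le_mul_of_nonneg_left htri (hc k).le
        _ ≤ clockW ε₀ k * (r / w k) + clockW ε₀ k * |z i k - ζ n i k| := by
            rw [mul_add]; exact add_le_add (mul_le_mul_of_nonneg_left hkick' (hc k).le) le_rfl
        _ ≤ r + clockW ε₀ P.k₁ * P.η n := add_le_add hcw hcη
        _ ≤ B := by linarith
    · -- ahead of `k₁`: kick + both tails
      have hz8 := hA i k hk
      have hζ8 := hζA i k hk
      have hz' : |z i k| ≤ r / (8 * w k) := by rw [le_div_iff₀ (by positivity)]; linarith
      have hζ' : |ζ n i k| ≤ r / (8 * w k) := by rw [le_div_iff₀ (by positivity)]; linarith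
      have hzζ : |z i k - ζ n i k| ≤ r / (8 * w k) + r / (8 * w k) := (abs_sub _ _).trans (add_le_add hz' hζ')
      have hsum : |S₀ i k - ζ n i k| ≤ 5 / 4 * (r / w k) := by
        have e : r / (8 * w k) + r / (8 * w k) = 1 / 4 * (r / w k) := by field_simp; ring
        linarith [htri, hkick', hzζ]
      have : 0 ≤ clockW ε₀ P.k₁ * P.η n := mul_nonneg (hc _).le hη
      calc clockW ε₀ k * |S₀ i k - ζ n i k| ≤ clockW ε₀ k * (5 / 4 * (r / w k)) := mul_le_mul_of_nonneg_left hsum (hc k).le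
        _ = 5 / 4 * (clockW ε₀ k * (r / w k)) := by ring
        _ ≤ 5 / 4 * r := by linarith
        _ ≤ B := by linarith

/-- **The clamped ratio is `1/A_*`-Lipschitz in the carrier.** [folklore (`max` is 1-Lipschitz); cell LADDER §50 (clamped anchor normalisation)] -/
theorem abs_clampedRatio_sub_le (P : TubeSchedule) (i₀ : Fin 2) (ε₀ θ₀ t : ℝ) (S Z : Fin 2 → ℤ → ℝ → ℝ) (hA : 0 < P.Astar) :
    |clampedRatio P i₀ ε₀ θ₀ t S - clampedRatio P i₀ ε₀ θ₀ t Z| ≤ |S i₀ 1 t - Z i₀ 1 t| / P.Astar := by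
  unfold clampedRatio
  refine (abs_max_sub_max_le_max _ _ _ _).trans ?_
  rw [sub_self, abs_zero, max_eq_right (abs_nonneg _), ← sub_div, abs_div, abs_of_pos hA]
  exact div_le_div_of_nonneg_right (abs_abs_sub_abs_le_abs_sub _ _) hA.le

/-- **The capture inequality from a sup deviation.** If `|S − Z| ≤ D` at the sites `(i₀, 1)` and `(i, 1+k)` at time `t`, `|Z_{i,1+k}(t)| ≤ M_Z`,
and the reference recentred with ITS OWN clamped ratio is within `ρ` of the target, then the premise recentred with its clamped ratio is within
`D·(1/f + M_Z/(A_* f²)) + ρ` of the target, `f = (1+ε₀)^{−θ₀}`. [cite: Tao2016AveragedNS, §6.4 (re-centring, statement shape); cell LADDER §50 (capture phase)] -/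
theorem recentre_sub_le_of_dev (P : TubeSchedule) (i₀ : Fin 2) {ε₀ θ₀ t : ℝ} (hε₀ : -1 < ε₀) (hA : 0 < P.Astar)
    {S Z : Fin 2 → ℤ → ℝ → ℝ} {i : Fin 2} {k : ℤ} {D MZ ρ c : ℝ}
    (hd1 : |S i₀ 1 t - Z i₀ 1 t| ≤ D) (hdk : |S i (1 + k) t - Z i (1 + k) t| ≤ D) (hZk : |Z i (1 + k) t| ≤ MZ)
    (href : |Z i (1 + k) t / clampedRatio P i₀ ε₀ θ₀ t Z - c| ≤ ρ) :
    |recentre S t (clampedRatio P i₀ ε₀ θ₀ t S) i k - c|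
      ≤ D * (1 / (1 + ε₀) ^ (-θ₀) + MZ / (P.Astar * ((1 + ε₀) ^ (-θ₀)) ^ 2)) + ρ := by
  set a := clampedRatio P i₀ ε₀ θ₀ t S with ha_def
  set aZ := clampedRatio P i₀ ε₀ θ₀ t Z with haZ_def
  set f := (1 + ε₀) ^ (-θ₀) with hf_def
  have hf : 0 < f := Real.rpow_pos_of_pos (by linarith) _
  have ha : f ≤ a := floor_le_clampedRatio P i₀ ε₀ θ₀ t S
  have haZ : f ≤ aZ := floor_le_clampedRatio P i₀ ε₀ θ₀ t Z
  have ha0 : 0 < a := hf.trans_le ha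
  have haZ0 : 0 < aZ := hf.trans_le haZ
  have hD0 : 0 ≤ D := (abs_nonneg _).trans hd1
  have hMZ0 : 0 ≤ MZ := (abs_nonneg _).trans hZk
  have haa : |a - aZ| ≤ D / P.Astar :=
    (abs_clampedRatio_sub_le P i₀ ε₀ θ₀ t S Z hA).trans (div_le_div_of_nonneg_right hd1 hA.le)
  -- the three pieces
  have h1 : |S i (1 + k) t / a - Z i (1 + k) t / a| ≤ D / f := by
    rw [← sub_div, abs_div, abs_of_pos ha0]
    exact div_le_div₀ hD0 hdk hf ha
  have h2 : |Z i (1 + k) t / a - Z i (1 + k) t / aZ| ≤ MZ * (D / P.Astar) / f ^ 2 := by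
    have e : Z i (1 + k) t / a - Z i (1 + k) t / aZ = Z i (1 + k) t * (aZ - a) / (a * aZ) := by
      rw [div_sub_div _ _ ha0.ne' haZ0.ne']; ring
    rw [e, abs_div, abs_mul, abs_of_pos (mul_pos ha0 haZ0)]
    have hnum : |Z i (1 + k) t| * |aZ - a| ≤ MZ * (D / P.Astar) := by
      rw [abs_sub_comm] ; exact mul_le_mul hZk haa (abs_nonneg _) hMZ0
    have hden : f ^ 2 ≤ a * aZ := by rw [sq]; exact mul_le_mul ha haZ hf.le ha0.le
    exact div_le_div₀ (by positivity) hnum (by positivity) hden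
  have e : recentre S t a i k - c = (S i (1 + k) t / a - Z i (1 + k) t / a) + (Z i (1 + k) t / a - Z i (1 + k) t / aZ)
      + (Z i (1 + k) t / aZ - c) := by simp only [recentre]; ring
  rw [e]
  calc _ ≤ |S i (1 + k) t / a - Z i (1 + k) t / a + (Z i (1 + k) t / a - Z i (1 + k) t / aZ)| + |Z i (1 + k) t / aZ - c| :=
        abs_add_le _ _
    _ ≤ (|S i (1 + k) t / a - Z i (1 + k) t / a| + |Z i (1 + k) t / a - Z i (1 + k) t / aZ|) + |Z i (1 + k) t / aZ - c| := by
        gcongr; exact abs_add_le _ _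
    _ ≤ (D / f + MZ * (D / P.Astar) / f ^ 2) + ρ := add_le_add (add_le_add h1 h2) href
    _ = D * (1 / f + MZ / (P.Astar * f ^ 2)) + ρ := by ring

section Capture

variable {ε ε₀ : ℝ}

/-- **`TubeStepCaptureWith` AT THE CHOICE RULE, hop `n + 1 ≤ N₀`, FROM FINITE-TIME CONTINUITY.** See the module docstring.
[cite: Tao2016AveragedNS, §5 (continuity argument), §6.2 Prop. 6.3 (ix), §6.3–6.4 (statement shape); route TaoLadderRungTwoFlat, `HopTube.TubeStepCaptureWith` (cell LADDER §47.5 L1/L3, §50)] -/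
theorem tubeStepCaptureWith_of_continuity (P : TubeSchedule) {Bcl : ℕ → (Fin 2 → ℤ → ℝ) → Prop} {i₀ : Fin 2}
    {X₀ : Fin 2 → ℝ} {w : ℤ → ℝ} {r θ₀ c₀ t₀ : ℝ} {ζ : ℕ → Fin 2 → ℤ → ℝ} {ustar : Fin 2 → ℤ → ℝ}
    {good : ℕ → (Fin 2 → ℤ → ℝ → ℝ) → ℝ → Prop} {n : ℕ} {Z FZ : Fin 2 → ℤ → ℝ → ℝ}
    (hε : 0 ≤ ε) (hε₀ : 0 < ε₀) (hn : n + 1 ≤ P.N₀) (hc₀ : 0 < c₀)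
    (hζ0 : ζ 0 = datumState i₀ X₀) (hη0 : 0 ≤ P.η 0) (hηn : 0 ≤ P.η n) (hk₁ : 1 ≤ P.k₁) (hr0 : 0 ≤ r)
    (hw1 : ∀ k, 1 ≤ w k) (hwc : ∀ k : ℤ, 0 ≤ k → clockW ε₀ k ≤ w k) (hAstar : 0 < P.Astar)
    (hθ₀ : 0 ≤ θ₀) (hθ₀1 : θ₀ ≤ 1) (hAFL : 0 < 1 - θ₀ * ε₀)
    -- the reference flow of the hop: exact, from the centre `ζ n`, on `[0, c₀]`; its weighted bound; the centre's tail
    (hZ : PseudoFlowOnShift shiftSetFlat c₀ ε₀ (mirrorTable ε ε) 0 0 (ζ n) (fun i k => (1 / 2) * ζ n i k ^ 2)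
      (fun _ _ => 0) Z FZ)
    {MZ B D : ℝ} (hMZ : 0 ≤ MZ) (hZb : ∀ i k, ∀ t ∈ Icc 0 c₀, max 1 (clockW ε₀ k) * |Z i k t| ≤ MZ)
    (hζA : AheadClause P w r (ζ n))
    (hB : 5 / 4 * r + clockW ε₀ P.k₁ * P.η n ≤ B)
    (hD : B * Real.exp (2 * tableAbsSum shiftSetFlat (renormTable ε₀ (mirrorTable ε ε)) * (MZ + 1)
      * (1 + ε₀) ^ ((5 : ℝ) / 2) * c₀) ≤ D)
    (hDhalf : D ≤ 1 / 2)
    -- good section times exist and lie in the clock window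
    {tlo : ℝ} (htlo : 0 < tlo)
    (hex : ∀ z S₀ τ S F, HopPremiseWith P Bcl shiftSetFlat ε₀ i₀ (mirrorTable ε ε) X₀ w r c₀ ζ ustar n z S₀ τ S F →
      ∃ t, good n S t)
    (hwin : ∀ z S₀ τ S F, HopPremiseWith P Bcl shiftSetFlat ε₀ i₀ (mirrorTable ε ε) X₀ w r c₀ ζ ustar n z S₀ τ S F →
      ∀ t, good n S t → tlo ≤ t ∧ t ≤ c₀)
    -- CAPTURE: the reference-only row on the window and the budget
    {ρ : ℝ} (href : ∀ t ∈ Icc tlo c₀, ∀ (i : Fin 2) (k : ℤ),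
      |Z i (1 + k) t / clampedRatio P i₀ ε₀ θ₀ t Z - ζ (n + 1) i k| ≤ ρ)
    (hbudget : D * (1 / (1 + ε₀) ^ (-θ₀) + MZ / (P.Astar * ((1 + ε₀) ^ (-θ₀)) ^ 2)) + ρ ≤ P.η (n + 1))
    -- AHEAD: window rows and window-top hull read off the reference (+ D); cut schedule
    {kH : ℤ} {Vtop : ℝ} {G Ω : ℤ → ℝ} (hk₁H : (P.k₁ : ℤ) ≤ kH + 2) (hVtop : 0 ≤ Vtop) (hG0 : ∀ j, kH < j → 0 ≤ G j)
    (hrefA : ∀ t ∈ Icc tlo c₀, ∀ (i : Fin 2) (k : ℤ), (P.k₁ : ℤ) ≤ k → k ≤ kH →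
      8 * (w k * (|Z i (1 + k) t| + D)) ≤ r * (1 - θ₀ * ε₀))
    (hrefV : ∀ t ∈ Icc 0 c₀, |Z 1 (kH + 1) t| + D ≤ Vtop)
    (hΩ : ∀ j, kH < j → ∀ N : Finset ℤ, (∀ m ∈ N, j < m) → ∑ m ∈ N, (w m)⁻¹ ^ 2 ≤ Ω j)
    (hGΩ : ∀ j, kH < j → 2 * (9 / 8 * r) ^ 2 * Ω j ≤ G j ^ 2)
    (hclose0 : 4 / 3 * c₀ * clock ε₀ (kH + 1) * Vtop * (Vtop + 2 * ε * G (kH + 1)) < G (kH + 1))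
    (hcloseG : ∀ j, kH + 1 ≤ j →
      4 / 3 * c₀ * clock ε₀ (j + 1) * (2 * G j) * (2 * G j + 2 * ε * G (j + 1)) < G (j + 1))
    (hGr : ∀ k, kH < k → 8 * (w k * (2 * G k)) ≤ r * (1 - θ₀ * ε₀)) :
    TubeStepCaptureWith P Bcl (choiceRule P i₀ ε₀ θ₀ t₀ good) shiftSetFlat ε₀ i₀ (mirrorTable ε ε) X₀ w r c₀ ζ ustar n := by
  have hε' : (-1 : ℝ) < ε₀ := by linarith
  have hc : ∀ k, 0 < clockW ε₀ k := clockW_pos hε'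
  have hw0 : ∀ k, 0 < w k := fun k => lt_of_lt_of_le one_pos (hw1 k)
  have hZc : ∀ i k, ∀ t ∈ Icc 0 c₀, clockW ε₀ k * |Z i k t| ≤ MZ := fun i k t ht =>
    (mul_le_mul_of_nonneg_right (le_max_right 1 _) (abs_nonneg _)).trans (hZb i k t ht)
  have hZp : ∀ i k, ∀ t ∈ Icc 0 c₀, |Z i k t| ≤ MZ := fun i k t ht =>
    (le_mul_of_one_le_left (abs_nonneg _) (le_max_left 1 _)).trans (hZb i k t ht)
  have hB0 : 0 ≤ B := by
    have := mul_nonneg (hc P.k₁).le hηn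
    linarith
  have hD0 : 0 ≤ D := le_trans (mul_nonneg hB0 (Real.exp_pos _).le) hD
  -- the deviation along every premise: `|S − Z| ≤ D` on `[0, c₀]` at every site
  have hdev : ∀ z S₀ τ S F, HopPremiseWith P Bcl shiftSetFlat ε₀ i₀ (mirrorTable ε ε) X₀ w r c₀ ζ ustar n z S₀ τ S F →
      ∀ (i : Fin 2) (k : ℤ), ∀ s ∈ Icc 0 c₀, |S i k s - Z i k s| ≤ D := by
    intro z S₀ τ S F hprem i k s hs
    obtain ⟨hz, hkick, hc₀τ, hflow⟩ := hprem
    obtain ⟨hcap, hA⟩ := capture_of_inTubeWith_le P (by omega) hζ0 hη0 hk₁ hr0 hz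
    have hB' := captureStart_le P hε₀.le hcap hA hζA hkick hw1 hwc hr0 hηn hB
    have hS' := pseudoFlowOnShift_mono hflow hc₀ hc₀τ
    have hsmall : B * Real.exp (2 * tableAbsSum shiftSetFlat (renormTable ε₀ (mirrorTable ε ε)) * (MZ + 1)
        * (1 + ε₀) ^ ((5 : ℝ) / 2) * c₀) ≤ 1 / 2 := hD.trans hDhalf
    have h := sup_deviation_of_gradedFlows hZ hS' hε₀ hc₀.le hMZ hZc hB' hsmall i k s hs
    have hT0 : 0 ≤ tableAbsSum shiftSetFlat (renormTable ε₀ (mirrorTable ε ε)) := tableAbsSum_nonneg _ _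
    have hL0 : 0 ≤ 2 * tableAbsSum shiftSetFlat (renormTable ε₀ (mirrorTable ε ε)) * (MZ + 1) * (1 + ε₀) ^ ((5 : ℝ) / 2) := by
      have : 0 ≤ (1 + ε₀) ^ ((5 : ℝ) / 2) := Real.rpow_nonneg (by linarith) _
      positivity
    have hmono : B * Real.exp (2 * tableAbsSum shiftSetFlat (renormTable ε₀ (mirrorTable ε ε)) * (MZ + 1)
        * (1 + ε₀) ^ ((5 : ℝ) / 2) * s) ≤ D :=
      (mul_le_mul_of_nonneg_left (Real.exp_le_exp.mpr (mul_le_mul_of_nonneg_left hs.2 hL0)) hB0).trans hD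
    exact ((le_mul_of_one_le_left (abs_nonneg _) (le_max_left 1 _)).trans h).trans hmono
  intro z S₀ τ S F hprem
  have hgood := chooseTime_spec (t₀ := t₀) (hex z S₀ τ S F hprem)
  set t := chooseTime good t₀ n S with ht_def
  obtain ⟨htlo_le, htc₀⟩ := hwin z S₀ τ S F hprem t hgood
  have htI : t ∈ Icc tlo c₀ := ⟨htlo_le, htc₀⟩
  have ht0 : t ∈ Icc 0 c₀ := ⟨htlo.le.trans htlo_le, htc₀⟩
  simp only [choiceRule_τ₁, choiceRule_a]
  refine ⟨fun i k => ?_, ?_⟩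
  · -- CAPTURE at `n + 1`
    have hd := hdev z S₀ τ S F hprem
    exact (recentre_sub_le_of_dev P i₀ hε' hAstar (hd i₀ 1 t ht0) (hd i (1 + k) t ht0) (hZp i (1 + k) t ht0)
      (href t htI i k)).trans hbudget
  · -- AHEAD of the landed state: the cut schedule with window rows and hull read off the reference
    have hwinA : AheadWindowWith P Bcl shiftSetFlat ε₀ i₀ (mirrorTable ε ε) X₀ w r c₀ ζ ustar good n kH (1 - θ₀ * ε₀) := by
      intro z' S₀' τ' S' F' hprem' t' ht' i k hk hkH
      obtain ⟨h1, h2⟩ := hwin z' S₀' τ' S' F' hprem' t' ht'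
      have hd := hdev z' S₀' τ' S' F' hprem' i (1 + k) t' ⟨htlo.le.trans h1, h2⟩
      have hS : |S' i (1 + k) t'| ≤ |Z i (1 + k) t'| + D := by
        have := abs_sub_abs_le_abs_sub (S' i (1 + k) t') (Z i (1 + k) t'); linarith
      exact (mul_le_mul_of_nonneg_left (mul_le_mul_of_nonneg_left hS (hw0 k).le) (by norm_num)).trans
        (hrefA t' ⟨h1, h2⟩ i k hk hkH)
    have hVt : ∀ z S₀ τ S F, HopPremiseWith P Bcl shiftSetFlat ε₀ i₀ (mirrorTable ε ε) X₀ w r c₀ ζ ustar n z S₀ τ S F →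
        ∀ t ∈ Icc 0 c₀, |S 1 (kH + 1) t| ≤ Vtop := by
      intro z' S₀' τ' S' F' hprem' t' ht'
      have hd := hdev z' S₀' τ' S' F' hprem' 1 (kH + 1) t' ht'
      have := abs_sub_abs_le_abs_sub (S' 1 (kH + 1) t') (Z 1 (kH + 1) t')
      linarith [hrefV t' ht']
    have hinit : ∀ j, kH < j → ∀ z S₀ τ S F,
        HopPremiseWith P Bcl shiftSetFlat ε₀ i₀ (mirrorTable ε ε) X₀ w r c₀ ζ ustar n z S₀ τ S F →
          ∀ N : Finset ℤ, (∀ m ∈ N, j < m) → ∑ m ∈ N, ∑ i : Fin 2, S₀ i m ^ 2 ≤ G j ^ 2 := by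
      intro j hj z' S₀' τ' S' F' hprem' N hN
      obtain ⟨hz', hkick', -, -⟩ := hprem'
      obtain ⟨-, hA'⟩ := capture_of_inTubeWith_le P (by omega) hζ0 hη0 hk₁ hr0 hz'
      exact (initialTail_le_of_clauses P hw0 hr0 hA' hkick' (by omega) hN (hΩ j hj N hN)).trans (hGΩ j hj)
    have hgoodI : ∀ z S₀ τ S F, HopPremiseWith P Bcl shiftSetFlat ε₀ i₀ (mirrorTable ε ε) X₀ w r c₀ ζ ustar n z S₀ τ S F →
        ∀ t, good n S t → t ∈ Icc 0 c₀ := fun z' S₀' τ' S' F' h' t' ht' =>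
      ⟨htlo.le.trans (hwin z' S₀' τ' S' F' h' t' ht').1, (hwin z' S₀' τ' S' F' h' t' ht').2⟩
    have hratio : ∀ z S₀ τ S F, HopPremiseWith P Bcl shiftSetFlat ε₀ i₀ (mirrorTable ε ε) X₀ w r c₀ ζ ustar n z S₀ τ S F →
        ∀ t, good n S t → 1 - θ₀ * ε₀ ≤ clampedRatio P i₀ ε₀ θ₀ t S :=
      fun z' S₀' τ' S' _ _ t' _ => one_sub_mul_le_clampedRatio P i₀ hε₀.le hθ₀ hθ₀1 t' S'
    exact aheadClause_of_schedule (a := fun S t => clampedRatio P i₀ ε₀ θ₀ t S) hε hε₀ hc₀.le hr0 (fun k => (hw0 k).le)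
      hAFL hVtop hG0 hwinA hVt hinit hclose0 hcloseG hGr hgoodI hratio z S₀ τ S F hprem t hgood

end Capture

end Summit.NavierStokesRegularity.NavierStokesRegularity.Theorems.HopTube

end
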